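import Literature.NumberTheory.LFunctions.AlternativeHypothesisConsequences
import Literature.NumberTheory.LFunctions.RHWave0GRHProofs
import HarnessLib

/-!
# Pair correlation estimates via semidefinite programming (Chirre–Gonçalves–de Laat, Adv. Math.
# 361 (2020)): `N*(T) ≤ 1.3208 N(T)` on RH, `67.92 %` simple and `84.77 %` distinct zeros, and
# `N(0.6039, T) ≫ N(T)`

LABEL (cell `landau-siegel`, sub-cell §C literature harvest, rung F-S3, row T-087 of
`lit/HARVEST.md`; tag **E*-ℓ**: positive-proportion statements for PAIRS of zeros closer than
`x` mean spacings on RH — the printed record `x = 0.6039` (RH), `0.5769` (GRH), to be compared with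
Conrey–Iwaniec's admissible `½(1 − 1/√log γ)`; deficit `0.104` resp. `0.077`). STATEMENT LAYER:
four NAMED FACTS (D-0014; `def … : Prop`, theorem-in-print, hypotheses `RiemannHypothesis` /
`GeneralizedRiemannHypothesis` EXPLICIT, nothing asserted) — Theorem 1, Corollary 2, Corollary 3,
Theorem 4 — over the tree's zero vocabulary (`zetaZeroBox`, `riemannZetaZeroOrder`,
`zetaZeroCount`, `simpleZeroCount`, `distinctZeroCount`, `GLSS2026.pairCount`), plus PROVED
bookkeeping: Corollary 2 from Theorem 1 (the paper's (2.1), `N_s ≥ 2N − N*`), Corollary 3 from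
Theorem 1 and Bui–Heath-Brown's `19/27` (the paper's (2.2), `2N_s ≤ N* − 5N + 6N_d`), and the
consistency of the multiplicity predicate with the tree's `Montgomery1973_sum_sq_multiplicity`
(`4/3`).

## What the source prints (held text `paper:arxiv-1810.08843` = Adv. Math. 361 (2020) 106926,
corpus-tex chunks p0003–p0004, read 2026-08-26)

§1.1 (p0003:L7–35): "Let `N(T)` count the number of zeros `ρ = β + iγ` of `ζ(s)`, repeated
according the multiplicity, such that `0 < β < 1` and `0 < γ ≤ T`. … Let `N*(T) := Σ_{0<γ≤T} m_ρ`,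
where the sum is over the non-trivial zeros of `ζ(s)` counting multiplicities and `m_ρ` is the
multiplicity of `ρ`. … it is conjectured that `N*(T) ∼ N(T)` (1.2) … Montgomery defined the pair
correlation function `N(x,T) := Σ_{0<γ,γ′≤T, 0<γ′−γ≤2πx/log T} 1` (1.3) for `x > 0`". (Footnote:
"For every sum over zeros in this article the involved quantities should be repeated according
to the multiplicity of the zero.")

> **Theorem 1** (p0004:L5–18). Assuming RH, we have `N*(T) ≤ (1.3208 + o(1))N(T)`. Assuming the
> Generalized Riemann Hypothesis for Dirichlet `L`-functions (GRH), we have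
> `N*(T) ≤ (1.3155 + o(1))N(T)`.

`N_s(T) := Σ_{0<γ≤T, m_ρ=1} 1`; "Using the fact that `N_s(T) ≥ Σ_{0<γ≤T}(2 − m_ρ) = 2N(T) − N*(T)`
(2.1) we obtain the following corollary."

> **Corollary 2** (p0004:L33–45). Assuming RH, we have `N_s(T) ≥ (0.6792 + o(1))N(T)`. Assuming
> GRH, we have `N_s(T) ≥ (0.6845 + o(1))N(T)`.

`N_d(T) := Σ_{0<γ≤T} 1/m_ρ` "the number of distinct zeros"; "Using the inequality
`2N_s(T) ≤ Σ_{0<γ≤T} (m_ρ−2)(m_ρ−3)/m_ρ = N*(T) − 5N(T) + 6N_d(T)` (2.2) in conjunction with the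
estimate `N_s(T) ≥ (19/27 + o(1))N(T)` and Theorem 1, we deduce the following corollary."

> **Corollary 3** (p0004:L69–81). Assuming RH, we have `N_d(T) ≥ (0.8477 + o(1))N(T)`. Assuming
> GRH, we have `N_d(T) ≥ (0.8486 + o(1))N(T)`.

> **Theorem 4** (p0004:L86–99). Assuming RH and (1.2), we have `N(0.6039,T) ≫ N(T)`. Assuming GRH
> and (1.2), we have `N(0.5769,T) ≫ N(T)`.

("Montgomery showed that `N(0.68…,T) ≫ N(T)` … GGOS `0.6072` … CCLM `0.6068…` … Assuming GRH and
(1.2), Goldston, Gonek, Özlük and Snyder showed the constant `0.5781…`.")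

## Lean rendering / design choices (audit notes for ls-lit-ref)

* `N*(T) = Σ_{0<γ≤T} m_ρ` WITH multiplicity `= Σ_{ρ distinct} m_ρ²` — written exactly as the tree
  already writes Montgomery's `Σ' m(ρ)²` (`SimpleZeros.lean`, `Montgomery1973_sum_sq_multiplicity`):
  `∑ᶠ ρ ∈ zetaZeroBox 0 T, riemannZetaZeroOrder ρ ^ 2 : ℤ` (`CGdL2020.nStar`); `N(T)` =
  `zetaZeroCount` (with multiplicity), `N_s` = `simpleZeroCount` (simple zeros IN THE STRIP, each
  once — the paper does not restrict to the line), `N_d` = `distinctZeroCount`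
  (`= (zetaZeroBox 0 T).ncard`); `N(x,T)` = the tree's `GLSS2026.pairCount T x`
  (`#{(ρ,ρ′) : 0 < γ,γ′ ≤ T, 0 < (γ−γ′)(log T/2π) ≤ x}`, pairs of indices with multiplicity — the
  same count with the roles of `γ, γ′` swapped).
* "`≤ (c + o(1))N(T)`" ⟹ `∀ ε > 0, ∀ᶠ T, N*(T) ≤ (c + ε)N(T)` (`CGdL2020.NStarLe c`, the shape of
  `Montgomery1973_sum_sq_multiplicity`, which is `RH → NStarLe (4/3)`: `nStarLe_montgomery_iff`);
  "`≥ (c + o(1))N(T)`" ⟹ `∀ ε > 0, ∀ᶠ T, (c − ε)N(T) ≤ …`; "`N(x,T) ≫ N(T)`" (as `T → ∞`) ⟹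
  `∃ A > 0, ∀ᶠ T, A·N(T) ≤ N(x,T)` (`CGdL2020.PairCountPos x`).
* HYPOTHESIS (1.2) `N*(T) ∼ N(T)` (a conjecture, consumed as an antecedent, never asserted): since
  `N*(T) ≥ N(T)` always, it is `NStarLe 1`; Theorem 4 is typed `RH → NStarLe 1 → PairCountPos 0.6039`.
  GRH = the tree's `GeneralizedRiemannHypothesis` (`RHWave0.lean`, all Dirichlet `L`-functions).
* Numerical constants verbatim (`1.3208`, `1.3155`, `0.6792`, `0.6845`, `0.8477`, `0.8486`,
  `0.6039`, `0.5769`); they are outputs of a numerically solved SDP whose optimality certificates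
  the paper discusses (§5) — typed as printed, not re-verified.

WHAT THIS IS NOT: no claim about RH, GRH, (1.2) or Siegel zeros. «The programme SEARCHES and
TYPES; no claim about Landau–Siegel zeros, Theorems 1–2 of arXiv:2211.02515 or a repaired
Margin232 until a kernel theorem says so.»

## References

* [ChirreGoncalvesDelaat2020] A. Chirre, F. Gonçalves, D. de Laat, *Pair correlation estimates for
  the zeros of the zeta function via semidefinite programming*, Adv. Math. 361 (2020) 106926,
  arXiv:1810.08843: §1.1 (1.1)–(1.4), §2 Theorem 1, (2.1), Corollary 2, (2.2), Corollary 3, Theorem 4.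
* [Montgomery1973], [BuiHeathbrown2013] — tree: `SimpleZeros.lean`
  (`Montgomery1973_sum_sq_multiplicity`, `BuiHeathbrown2013_simple_zeros`).
* Tree: `AlternativeHypothesisConsequences.lean` (`GLSS2026.pairCount`), `ZetaZeros.lean`.
-/

noncomputable section

open Filter

namespace Literature.NumberTheory.LFunctions

namespace CGdL2020

/-- **`N*(T) = Σ_{0<γ≤T} m_ρ`** (zeros WITH multiplicity, each weighted by its multiplicity), i.e.
`Σ_{ρ distinct, 0<γ≤T} m_ρ²`, as an integer. [cite: ChirreGoncalvesDelaat2020, §1.1 (definition of N*)] -/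
def nStar (T : ℝ) : ℤ :=
  ∑ᶠ ρ ∈ zetaZeroBox 0 T, riemannZetaZeroOrder ρ ^ 2

/-- **`N*(T) ≤ (c + o(1)) N(T)`**, junk-free: for every `ε > 0` and all large `T`,
`N*(T) ≤ (c + ε) N(T)`. [cite: ChirreGoncalvesDelaat2020, §1.1 (1.4)] -/
def NStarLe (c : ℝ) : Prop :=
  ∀ ε : ℝ, 0 < ε → ∀ᶠ T : ℝ in atTop, (nStar T : ℝ) ≤ (c + ε) * zetaZeroCount T

/-- **`N(x,T) ≫ N(T)`** (as `T → ∞`): `∃ A > 0, ∀ᶠ T, A·N(T) ≤ N(x,T)`, with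
`N(x,T) = #{0 < γ,γ′ ≤ T : 0 < γ′ − γ ≤ 2πx/log T}` = the tree's `GLSS2026.pairCount T x`.
[cite: ChirreGoncalvesDelaat2020, §1.1 (1.3), (1.5)] -/
def PairCountPos (x : ℝ) : Prop :=
  ∃ A : ℝ, 0 < A ∧ ∀ᶠ T : ℝ in atTop, A * zetaZeroCount T ≤ (GLSS2026.pairCount T x : ℝ)

/-! #### API (proved) -/

/-- `NStarLe` is upward monotone in the constant. [cite: ChirreGoncalvesDelaat2020, §1.1 (1.4)] -/
theorem NStarLe.mono {c c' : ℝ} (hle : c ≤ c') (h : NStarLe c) : NStarLe c' := by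
  intro ε hε
  filter_upwards [h ε hε] with T hT
  exact hT.trans (mul_le_mul_of_nonneg_right (by linarith) (Nat.cast_nonneg _))

/-- `PairCountPos` is upward monotone in `x` (`N(x,T)` is non-decreasing in `x`).
[cite: ChirreGoncalvesDelaat2020, §1.1 (1.3)] -/
theorem PairCountPos.mono {x x' : ℝ} (hle : x ≤ x') (h : PairCountPos x) : PairCountPos x' := by
  obtain ⟨A, hA, hT⟩ := h
  refine ⟨A, hA, ?_⟩
  filter_upwards [hT] with T hT'
  have hle' : GLSS2026.pairCount T x ≤ GLSS2026.pairCount T x' := by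
    classical
    unfold GLSS2026.pairCount
    refine Finset.card_le_card fun p hp => ?_
    rw [Finset.mem_filter] at hp ⊢
    exact ⟨hp.1, hp.2.1, hp.2.2.trans hle⟩
  exact hT'.trans (by exact_mod_cast hle')

/-- The tree's Montgomery fact `Σ' m(ρ)² ≤ (4/3 + o(1))N(T)` on RH is `RH → NStarLe (4/3)`
(same object, same quantifier shape). [cite: ChirreGoncalvesDelaat2020, §2 ("Montgomery was the first to show the constant 4/3")] -/
theorem nStarLe_montgomery_iff :
    Montgomery1973_sum_sq_multiplicity ↔ (RiemannHypothesis → NStarLe (4 / 3)) :=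
  Iff.rfl

end CGdL2020

open CGdL2020

/-! ### The named facts -/

/-- **Chirre–Gonçalves–de Laat 2020, Theorem 1.** "Assuming RH, we have
`N*(T) ≤ (1.3208 + o(1))N(T)`. Assuming the Generalized Riemann Hypothesis for Dirichlet
`L`-functions (GRH), we have `N*(T) ≤ (1.3155 + o(1))N(T)`", `N*(T) = Σ_{0<γ≤T} m_ρ` with
multiplicity. (History printed there: Montgomery `4/3`, Montgomery–Taylor `1.3275`, GGOS `1.3262`
on GRH.) NAMED FACT, not proved here (Cohn–Elkies-class test functions optimised by semidefinite
programming in Montgomery's explicit-formula inequality). [cite: ChirreGoncalvesDelaat2020, Theorem 1] -/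
def chirreGoncalvesDeLaat2020_theorem1 : Prop :=
  (RiemannHypothesis → NStarLe 1.3208) ∧ (GeneralizedRiemannHypothesis → NStarLe 1.3155)

/-- **Chirre–Gonçalves–de Laat 2020, Corollary 2.** "Assuming RH, we have
`N_s(T) ≥ (0.6792 + o(1))N(T)`. Assuming GRH, we have `N_s(T) ≥ (0.6845 + o(1))N(T)`",
`N_s(T)` = the number of SIMPLE zeros with `0 < γ ≤ T`. Follows from Theorem 1 by (2.1)
(`chirreGoncalvesDeLaat2020_corollary2_of_theorem1`, proved). [cite: ChirreGoncalvesDelaat2020, Corollary 2] -/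
def chirreGoncalvesDeLaat2020_corollary2 : Prop :=
  (RiemannHypothesis → ∀ ε : ℝ, 0 < ε → ∀ᶠ T : ℝ in atTop,
      (0.6792 - ε) * (zetaZeroCount T : ℝ) ≤ simpleZeroCount T) ∧
    (GeneralizedRiemannHypothesis → ∀ ε : ℝ, 0 < ε → ∀ᶠ T : ℝ in atTop,
      (0.6845 - ε) * (zetaZeroCount T : ℝ) ≤ simpleZeroCount T)

/-- **Chirre–Gonçalves–de Laat 2020, Corollary 3.** "Assuming RH, we have
`N_d(T) ≥ (0.8477 + o(1))N(T)`. Assuming GRH, we have `N_d(T) ≥ (0.8486 + o(1))N(T)`",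
`N_d(T)` = the number of DISTINCT zeros with `0 < γ ≤ T`. Follows from Theorem 1, Bui–Heath-Brown's
`N_s ≥ (19/27 + o(1))N` and (2.2) (`chirreGoncalvesDeLaat2020_corollary3_of_theorem1`, proved).
[cite: ChirreGoncalvesDelaat2020, Corollary 3] -/
def chirreGoncalvesDeLaat2020_corollary3 : Prop :=
  (RiemannHypothesis → ∀ ε : ℝ, 0 < ε → ∀ᶠ T : ℝ in atTop,
      (0.8477 - ε) * (zetaZeroCount T : ℝ) ≤ distinctZeroCount T) ∧
    (GeneralizedRiemannHypothesis → ∀ ε : ℝ, 0 < ε → ∀ᶠ T : ℝ in atTop,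
      (0.8486 - ε) * (zetaZeroCount T : ℝ) ≤ distinctZeroCount T)

/-- **Chirre–Gonçalves–de Laat 2020, Theorem 4** (the printed record for the minimal non-zero
value of Montgomery's pair count). "Assuming RH and (1.2) [`N*(T) ∼ N(T)`], we have
`N(0.6039,T) ≫ N(T)`. Assuming GRH and (1.2), we have `N(0.5769,T) ≫ N(T)`", where
`N(x,T) = #{0 < γ,γ′ ≤ T : 0 < γ′ − γ ≤ 2πx/log T}` (pairs with multiplicity). The hypothesis
(1.2) is an explicit antecedent (`NStarLe 1`), never asserted; the typed statement is the printed
IMPLICATION, a theorem. (History printed there: Montgomery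
`0.68`, GGOS `0.6072`, CCLM `0.6068`; GGOS `0.5781` on GRH + (1.2).) NAMED FACT, not proved here.
[cite: ChirreGoncalvesDelaat2020, Theorem 4] -/
def chirreGoncalvesDeLaat2020_theorem4 : Prop :=
  (RiemannHypothesis → NStarLe 1 → PairCountPos 0.6039) ∧
    (GeneralizedRiemannHypothesis → NStarLe 1 → PairCountPos 0.5769)

/-! ### Bookkeeping (proved): (2.1) and (2.2) -/

/-- The pointwise inequality behind (2.2): for an integer `m ≥ 1`, `2·[m = 1] ≤ (m − 2)(m − 3)`.
[cite: ChirreGoncalvesDelaat2020, (2.2)] -/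
theorem CGdL2020.two_mul_indicator_le (m : ℤ) (hm : 1 ≤ m) :
    2 * (if m = 1 then (1 : ℤ) else 0) ≤ (m - 2) * (m - 3) := by
  split_ifs with h
  · subst h; norm_num
  · rcases lt_or_ge m 4 with h4 | h4
    · interval_cases m <;> simp_all
    · nlinarith

/-- (2.2) on a finite set: for integer weights `m ≥ 1`,
`2·#{m = 1} ≤ Σ m² − 5 Σ m + 6·#s`. [cite: ChirreGoncalvesDelaat2020, (2.2)] -/
theorem CGdL2020.two_mul_card_filter_eq_one_le {α : Type*} (s : Finset α) (m : α → ℤ)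
    (hm : ∀ x ∈ s, 1 ≤ m x) :
    2 * ((s.filter fun x => m x = 1).card : ℤ) ≤
      ∑ x ∈ s, m x ^ 2 - 5 * ∑ x ∈ s, m x + 6 * s.card := by
  have h1 : ((s.filter fun x => m x = 1).card : ℤ) = ∑ x ∈ s, (if m x = 1 then (1 : ℤ) else 0) := by
    rw [Finset.card_filter]; push_cast; rfl
  have h2 : (∑ x ∈ s, m x ^ 2 - 5 * ∑ x ∈ s, m x + 6 * s.card : ℤ) =
      ∑ x ∈ s, (m x - 2) * (m x - 3) := by
    rw [Finset.card_eq_sum_ones]; push_cast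
    rw [Finset.mul_sum, Finset.mul_sum, ← Finset.sum_sub_distrib, ← Finset.sum_add_distrib]
    exact Finset.sum_congr rfl fun x _ => by ring
  rw [h1, h2, Finset.mul_sum]
  exact Finset.sum_le_sum fun x hx => CGdL2020.two_mul_indicator_le (m x) (hm x hx)

/-- The three counts over the finite set of distinct zeros of the box: `N(T) = Σ m`,
`N*(T) = Σ m²`, `N_s(T) = #{m = 1}`, `N_d(T) = #s`. [cite: ChirreGoncalvesDelaat2020, §1.1, §2] -/
theorem CGdL2020.counts_eq (T : ℝ) :
    let s : Finset ℂ := (zetaZeroBox_finite 0 T).toFinset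
    (zetaZeroCount T : ℤ) = ∑ ρ ∈ s, riemannZetaZeroOrder ρ ∧
      nStar T = ∑ ρ ∈ s, riemannZetaZeroOrder ρ ^ 2 ∧
      (simpleZeroCount T : ℤ) = ((s.filter fun ρ => riemannZetaZeroOrder ρ = 1).card : ℤ) ∧
      (distinctZeroCount T : ℤ) = (s.card : ℤ) := by
  intro s
  have hB : (zetaZeroBox 0 T).Finite := zetaZeroBox_finite 0 T
  refine ⟨?_, finsum_mem_eq_finite_toFinset_sum _ hB, ?_, ?_⟩
  · have hsum : ∑ᶠ ρ ∈ zetaZeroBox 0 T, riemannZetaZeroOrder ρ = ∑ ρ ∈ s, riemannZetaZeroOrder ρ :=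
      finsum_mem_eq_finite_toFinset_sum _ hB
    have hnn : 0 ≤ ∑ ρ ∈ s, riemannZetaZeroOrder ρ :=
      Finset.sum_nonneg fun ρ hρ =>
        (DiophantineGeometry.riemannZetaZeroOrder_pos_of_mem_zetaZeroBox
          ((Set.Finite.mem_toFinset hB).1 hρ)).le
    simp only [zetaZeroCount, zetaZeroCountRe, hsum]
    exact Int.toNat_of_nonneg hnn
  · have hset : {ρ ∈ zetaZeroBox 0 T | riemannZetaZeroOrder ρ = 1} =
        ↑(s.filter fun ρ => riemannZetaZeroOrder ρ = 1) := by
      ext ρ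
      simp [s, Set.Finite.mem_toFinset]
    simp only [simpleZeroCount, hset, Set.ncard_coe_finset]
  · simp only [distinctZeroCount, s, Set.ncard_eq_toFinset_card _ hB]

/-- **(2.1): `2N(T) − N*(T) ≤ N_s(T)`** (unconditional counting). [cite: ChirreGoncalvesDelaat2020, (2.1)] -/
theorem CGdL2020.two_mul_count_sub_nStar_le (T : ℝ) :
    2 * (zetaZeroCount T : ℝ) - nStar T ≤ simpleZeroCount T := by
  obtain ⟨hN, hS, hNs, -⟩ := CGdL2020.counts_eq T
  have hB : (zetaZeroBox 0 T).Finite := zetaZeroBox_finite 0 T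
  have key := two_mul_sum_sub_sum_sq_le_card_filter_eq_one hB.toFinset riemannZetaZeroOrder
    fun ρ hρ => DiophantineGeometry.riemannZetaZeroOrder_pos_of_mem_zetaZeroBox
      ((Set.Finite.mem_toFinset hB).1 hρ)
  rw [← hN, ← hS, ← hNs] at key
  have : ((2 * (zetaZeroCount T : ℤ) - nStar T : ℤ) : ℝ) ≤ ((simpleZeroCount T : ℤ) : ℝ) := by
    exact_mod_cast key
  push_cast at this
  exact this

/-- **(2.2): `2N_s(T) ≤ N*(T) − 5N(T) + 6N_d(T)`** (unconditional counting).
[cite: ChirreGoncalvesDelaat2020, (2.2)] -/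
theorem CGdL2020.two_mul_simple_le (T : ℝ) :
    2 * (simpleZeroCount T : ℝ) ≤ nStar T - 5 * zetaZeroCount T + 6 * distinctZeroCount T := by
  obtain ⟨hN, hS, hNs, hNd⟩ := CGdL2020.counts_eq T
  have hB : (zetaZeroBox 0 T).Finite := zetaZeroBox_finite 0 T
  have key := CGdL2020.two_mul_card_filter_eq_one_le hB.toFinset riemannZetaZeroOrder
    fun ρ hρ => DiophantineGeometry.riemannZetaZeroOrder_pos_of_mem_zetaZeroBox
      ((Set.Finite.mem_toFinset hB).1 hρ)
  rw [← hN, ← hS, ← hNs, ← hNd] at key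
  have : ((2 * (simpleZeroCount T : ℤ) : ℤ) : ℝ) ≤
      ((nStar T - 5 * (zetaZeroCount T : ℤ) + 6 * (distinctZeroCount T : ℤ) : ℤ) : ℝ) := by
    exact_mod_cast key
  push_cast at this
  exact this

/-- From a multiplicity bound to simple zeros: `NStarLe c` gives
`N_s(T) ≥ (2 − c − ε)N(T)` for all large `T`. [cite: ChirreGoncalvesDelaat2020, (2.1)] -/
theorem CGdL2020.NStarLe.simple_zeros {c : ℝ} (h : NStarLe c) :
    ∀ ε : ℝ, 0 < ε → ∀ᶠ T : ℝ in atTop, (2 - c - ε) * (zetaZeroCount T : ℝ) ≤ simpleZeroCount T := by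
  intro ε hε
  filter_upwards [h ε hε] with T hT
  have := CGdL2020.two_mul_count_sub_nStar_le T
  nlinarith [Nat.cast_nonneg (α := ℝ) (zetaZeroCount T)]

/-- **Corollary 2 from Theorem 1** (`2 − 1.3208 = 0.6792`, `2 − 1.3155 = 0.6845`).
[cite: ChirreGoncalvesDelaat2020, Corollary 2] -/
theorem chirreGoncalvesDeLaat2020_corollary2_of_theorem1 (h : chirreGoncalvesDeLaat2020_theorem1) :
    chirreGoncalvesDeLaat2020_corollary2 := by
  refine ⟨fun hRH ε hε => ?_, fun hGRH ε hε => ?_⟩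
  · filter_upwards [(h.1 hRH).simple_zeros ε hε] with T hT
    norm_num at hT ⊢; linarith
  · filter_upwards [(h.2 hGRH).simple_zeros ε hε] with T hT
    norm_num at hT ⊢; linarith

/-- From a multiplicity bound and a simple-zero proportion to distinct zeros via (2.2):
`NStarLe c` and `N_s ≥ (κ − ε)N` eventually give `N_d ≥ ((2κ − c + 5)/6 − ε)N` eventually.
[cite: ChirreGoncalvesDelaat2020, (2.2)] -/
theorem CGdL2020.NStarLe.distinct_zeros {c κ : ℝ} (h : NStarLe c)
    (hs : ∀ ε : ℝ, 0 < ε → ∀ᶠ T : ℝ in atTop, (κ - ε) * (zetaZeroCount T : ℝ) ≤ simpleZeroCount T) :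
    ∀ ε : ℝ, 0 < ε → ∀ᶠ T : ℝ in atTop,
      ((2 * κ - c + 5) / 6 - ε) * (zetaZeroCount T : ℝ) ≤ distinctZeroCount T := by
  intro ε hε
  filter_upwards [h ε hε, hs ε hε] with T hT hsT
  have := CGdL2020.two_mul_simple_le T
  nlinarith [Nat.cast_nonneg (α := ℝ) (zetaZeroCount T)]

/-- **Corollary 3 from Theorem 1 and Bui–Heath-Brown's `19/27`**
(`(2·19/27 − 1.3208 + 5)/6 = 0.84776… ≥ 0.8477`, `(2·19/27 − 1.3155 + 5)/6 = 0.84864… ≥ 0.8486`;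
GRH implies RH for `ζ = L(s, 1)`, `GeneralizedRiemannHypothesis.riemannHypothesis`).
[cite: ChirreGoncalvesDelaat2020, Corollary 3] -/
theorem chirreGoncalvesDeLaat2020_corollary3_of_theorem1 (h : chirreGoncalvesDeLaat2020_theorem1)
    (hBHB : BuiHeathbrown2013_simple_zeros) : chirreGoncalvesDeLaat2020_corollary3 := by
  refine ⟨fun hRH ε hε => ?_, fun hGRH ε hε => ?_⟩
  · filter_upwards [(h.1 hRH).distinct_zeros (hBHB hRH) ε hε] with T hT
    refine hT.trans' (mul_le_mul_of_nonneg_right ?_ (Nat.cast_nonneg _))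
    norm_num
  · have hRH : RiemannHypothesis := hGRH.riemannHypothesis
    filter_upwards [(h.2 hGRH).distinct_zeros (hBHB hRH) ε hε] with T hT
    refine hT.trans' (mul_le_mul_of_nonneg_right ?_ (Nat.cast_nonneg _))
    norm_num

end Literature.NumberTheory.LFunctions

end
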